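import Mathlib.Topology.MetricSpace.Ultra.TotallySeparated
import Mathlib.CategoryTheory.Adjunction.Additive
import Mathlib.Algebra.Category.Grp.Preadditive
import Literature.AlgebraicGeometry.Motives.EllAdicCohomologyGroups
import HarnessLib

/-!
# `H⁰_proét(X_{k̄}, ℤ_ℓ) ≅ ℤ_ℓ`: discharge of a named fact

Real proofs (D-0014 discharge) for `Literature/AlgebraicGeometry/Motives/EllAdicCohomologyGroups.lean`:

* `Literature.AlgebraicGeometry.Motives.nonempty_addEquiv_ellAdicCohomology_zero` : for every
  scheme `Y` with preconnected non-empty underlying space and every prime `ℓ`, Mathlib's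
  pro-étale `ℓ`-adic cohomology group `Y.EllAdicCohomology ℓ 0 = H⁰_proét(Y, ℤ_ℓ)` is isomorphic
  to `ℤ_ℓ` (Mathlib itself only records triviality for the empty scheme);
* `Literature.AlgebraicGeometry.Motives.irreducibleSpace_baseChange_algebraicClosure` : `X_{k̄}` is
  irreducible for `X` smooth projective geometrically irreducible over `k`;
* `Literature.AlgebraicGeometry.Motives.nonempty_addEquiv_geometricEllAdicCohomology_zero_holds` :
  the named fact `nonempty_addEquiv_geometricEllAdicCohomology_zero k` holds for every field `k`.

## Proof

`H⁰ = Ext⁰(ℤ, G) = Hom(ℤ, G)` (`Sheaf.H`, Mathlib `Abelian.Ext.addEquiv₀`), where `G` is the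
sheaf `U ↦ C(U, ℤ_ℓ)` (lifted to `Ab.{u+1}`) on the small pro-étale site of `Y`; `Y` (with `𝟙 Y`)
is a terminal object of that site (Bhatt–Scholze 2015, Lemma 4.1.8; here: the fully faithful
`Scheme.ProEt.forget` reflects the terminal object `Over.mk (𝟙 Y)`), so the constant-sheaf
adjunction (Mathlib `constantSheafAdj`, made additive by `Adjunction.homAddEquiv`) gives
`Hom(ℤ_const, G) = Hom(ℤ, G(Y))`; `G(Y) = ULift C(Y, ℤ_ℓ)` holds by `rfl` (Bhatt–Scholze
Def. 6.8.1, Lemma 4.2.12); `Hom(ℤ, A) = A` by evaluation at `1`; and a continuous map from the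
preconnected `Y` to the totally disconnected `ℤ_ℓ` (ultrametric) is constant
(`isPreconnected_range`, `IsPreconnected.subsingleton`), so `C(Y, ℤ_ℓ) = ℤ_ℓ` as `Y ≠ ∅`.
For `X_{k̄}`, irreducibility (hence connectedness and non-emptiness) is Mathlib's
`GeometricallyIrreducible` applied to the field `k̄` (`pullback_of_geometrically`).

## References

* B. Bhatt, P. Scholze, *The pro-étale topology for schemes*, Astérisque 369 (2015),
  Lemma 4.1.8, Lemma 4.2.12, Def. 6.8.1. [BhattScholze2015]

## Design notes

* Theorems only (no new `def`/`instance`): the terminal-object witness, the `WeaklyEtale (𝟙 Y)`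
  instance and the two auxiliary additive equivalences (`Hom(ULift ℤ, A) ≃+ A`,
  `C(Y, ℤ_ℓ) ≃+ ℤ_ℓ`) are built locally inside the proof.
* Mathlib searches: no lemma computes `Sheaf.H _ 0` or `EllAdicCohomology` in any degree (the TODO
  in `Mathlib/CategoryTheory/Sites/SheafCohomology/Basic.lean` asks for exactly the degree-`0`
  identification); used: `Abelian.Ext.addEquiv₀`, `constantSheafAdj`, `Adjunction.homAddEquiv`,
  `Adjunction.left_adjoint_additive`, `IsTerminal.isTerminalOfObj`, `Over.mkIdTerminal`,
  `zmultiplesHom`, `AddEquiv.ulift`, `isPreconnected_range`, `IsPreconnected.subsingleton`,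
  `pullback_of_geometrically`.
-/

universe u

open CategoryTheory Limits Opposite AlgebraicGeometry

namespace Literature.AlgebraicGeometry.Motives

section General

/-- **`H⁰_proét(Y, ℤ_ℓ) ≅ ℤ_ℓ` for a connected non-empty scheme.** For a scheme `Y` whose
underlying space is preconnected and non-empty and any prime `ℓ`, Mathlib's pro-étale `ℓ`-adic
cohomology group `H⁰_proét(Y, ℤ_ℓ) = Ext⁰(ℤ, 𝓞_{ℚ_ℓ,Y})` is isomorphic to `ℤ_ℓ` as an additive
group. Real proof: `Ext⁰ = Hom` (Mathlib `Abelian.Ext.addEquiv₀`); `Hom(ℤ_const, G) = Hom(ℤ, G(Y))`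
by the constant-sheaf adjunction at the terminal object `Y` of the small pro-étale site
(Bhatt–Scholze 2015, Lemma 4.1.8; Mathlib `constantSheafAdj`, `Adjunction.homAddEquiv`);
`G(Y) = C(Y, ℤ_ℓ)` by definition of the sheaf `U ↦ C(U, ℤ_ℓ)` (Bhatt–Scholze Def. 6.8.1,
Lemma 4.2.12); and a continuous map from a preconnected space to the totally disconnected `ℤ_ℓ`
is constant. [cite: BhattScholze2015, Lemma 4.1.8, Lemma 4.2.12 and Def. 6.8.1] -/
theorem nonempty_addEquiv_ellAdicCohomology_zero (Y : Scheme.{u}) [PreconnectedSpace Y]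
    [Nonempty Y] (ℓ : ℕ) [Fact ℓ.Prime] : Nonempty (Y.EllAdicCohomology ℓ 0 ≃+ ℤ_[ℓ]) := by
  haveI : WeaklyEtale (𝟙 Y) := MorphismProperty.id_mem _ Y
  let J := Scheme.ProEt.topology Y
  -- `Y` itself is a terminal object of its small pro-étale site
  let T : Y.ProEt := Scheme.ProEt.mk (𝟙 Y)
  have hT : IsTerminal T := IsTerminal.isTerminalOfObj (Scheme.ProEt.forget Y) _ Over.mkIdTerminal
  let G : Sheaf J AddCommGrpCat.{u + 1} :=
    (sheafCompose J AddCommGrpCat.uliftFunctor.{u + 1}).obj (Y.ellAdicSheaf ℓ)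
  let Z : AddCommGrpCat.{u + 1} := AddCommGrpCat.of (ULift.{u + 1} ℤ)
  -- step 1 : `H⁰ = Ext⁰(ℤ, G) ≃+ Hom(ℤ, G)`
  let e₁ : Y.EllAdicCohomology ℓ 0 ≃+ ((constantSheaf J AddCommGrpCat.{u + 1}).obj Z ⟶ G) :=
    Abelian.Ext.addEquiv₀
  -- step 2 : the constant sheaf adjunction at the terminal object `T`
  let adj := constantSheafAdj J AddCommGrpCat.{u + 1} hT
  haveI : ((sheafSections J AddCommGrpCat.{u + 1}).obj (op T)).Additive := ⟨rfl⟩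
  haveI := adj.left_adjoint_additive
  let e₂ : ((constantSheaf J AddCommGrpCat.{u + 1}).obj Z ⟶ G) ≃+ (Z ⟶ G.obj.obj (op T)) :=
    adj.homAddEquiv Z G
  -- step 3 : `Hom(ℤ, A) ≃+ A` (evaluation at `1`), for `A = G(T) = ULift C(Y, ℤ_ℓ)`
  let e₃ : (Z ⟶ G.obj.obj (op T)) ≃+ G.obj.obj (op T) :=
    { toFun := fun φ => φ.hom (ULift.up 1)
      invFun := fun a =>
        AddCommGrpCat.ofHom ((zmultiplesHom _ a).comp AddEquiv.ulift.toAddMonoidHom)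
      left_inv := fun φ => by
        apply AddCommGrpCat.hom_ext
        apply AddMonoidHom.ext
        rintro ⟨n⟩
        change n • φ.hom (ULift.up 1) = φ.hom (ULift.up n)
        rw [← map_zsmul]
        congr 1
        ext
        change n • (1 : ℤ) = n
        simp
      right_inv := fun a => by
        change (1 : ℤ) • a = a
        exact one_zsmul a
      map_add' := fun φ ψ => by simp }
  -- step 4 : `G(T) = ULift C(Y, ℤ_ℓ)` definitionally, and continuous maps from the preconnected
  -- non-empty `Y` to the totally disconnected `ℤ_ℓ` are the constants
  let e₄ : G.obj.obj (op T) ≃+ C(Y, ℤ_[ℓ]) := AddEquiv.ulift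
  let e₅ : C(Y, ℤ_[ℓ]) ≃+ ℤ_[ℓ] :=
    { toFun := fun f => f (Classical.arbitrary Y)
      invFun := fun c => ContinuousMap.const Y c
      left_inv := fun f => by
        ext s
        exact (isPreconnected_range f.continuous).subsingleton ⟨Classical.arbitrary Y, rfl⟩ ⟨s, rfl⟩
      right_inv := fun c => rfl
      map_add' := fun f g => rfl }
  exact ⟨e₁.trans (e₂.trans (e₃.trans (e₄.trans e₅)))⟩

end General

section SmoothProjective

variable {k : Type u} [Field k]

/-- The base change `X_{k̄}` to `AlgebraicClosure k` of a smooth projective geometrically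
irreducible `k`-variety is an irreducible topological space (geometric irreducibility of
`X → Spec k` applied to the field `k̄`; Mathlib `pullback_of_geometrically`). [folklore] -/
theorem irreducibleSpace_baseChange_algebraicClosure {n : ℕ} {X : SchemeOver k}
    (hX : IsSmoothProjective n X) :
    IrreducibleSpace ↥((baseChange k (AlgebraicClosure k)).obj X).left :=
  pullback_of_geometrically hX.geometricallyIrreducible.geometrically_irreducibleSpace
    (AlgebraicClosure k) (Spec.map (CommRingCat.ofHom (algebraMap k (AlgebraicClosure k))))

/-- **Discharge of the named fact `nonempty_addEquiv_geometricEllAdicCohomology_zero`**: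
for `X` smooth projective geometrically irreducible of dimension `n` over any field `k` and any
prime `ℓ` (the hypothesis `(ℓ : k) ≠ 0` of the fact is not needed), `H⁰_proét(X_{k̄}, ℤ_ℓ) ≅ ℤ_ℓ`:
`X_{k̄}` is irreducible, hence preconnected and non-empty, and
`nonempty_addEquiv_ellAdicCohomology_zero` applies (Bhatt–Scholze 2015, Lemma 4.1.8,
Lemma 4.2.12, Def. 6.8.1). [cite: BhattScholze2015, Lemma 4.2.12 and Def. 6.8.1] -/
theorem nonempty_addEquiv_geometricEllAdicCohomology_zero_holds :
    nonempty_addEquiv_geometricEllAdicCohomology_zero k := by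
  intro n X hX ℓ _ _
  haveI := irreducibleSpace_baseChange_algebraicClosure hX
  exact nonempty_addEquiv_ellAdicCohomology_zero _ ℓ

/-- Corollary of the discharge: `H⁰_proét(X_{k̄}, ℤ_ℓ)` is non-trivial for `X` smooth projective
(unconditional form of `nonempty_addEquiv_geometricEllAdicCohomology_zero.nontrivial`).
[folklore] -/
theorem nontrivial_geometricEllAdicCohomology_zero {n : ℕ} {X : SchemeOver k}
    (hX : IsSmoothProjective n X) (ℓ : ℕ) [Fact ℓ.Prime] (hℓ : (ℓ : k) ≠ 0) :
    Nontrivial (geometricEllAdicCohomology k X ℓ 0) := by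
  obtain ⟨e⟩ := nonempty_addEquiv_geometricEllAdicCohomology_zero_holds hX ℓ hℓ
  exact ⟨⟨e.symm 0, e.symm 1, fun h => zero_ne_one (e.symm.injective h)⟩⟩

end SmoothProjective

end Literature.AlgebraicGeometry.Motives
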